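import Mathlib
import Summits.KontsevichZagierPeriods.KontsevichZagierPeriods.Theorems.SoloInformedAlgebraicHull
import Summits.KontsevichZagierPeriods.KontsevichZagierPeriods.Theorems.SoloInformedDuplicationChain
import Summits.KontsevichZagierPeriods.KontsevichZagierPeriods.Theorems.SoloInformedIsogenySector
import HarnessLib
import HarnessLib.Audit

/-!
# SoloInformed — decided `K`-hulls `K[⟦β(a,½)⟧,⟦π⟧]`, `a ∈ {¼, ⅓, ⅙}` (Theorem IX⁗, III)

Assembly of Theorem IX⁗: the point field `K ⊂ P` and algebraic descent
(`SoloInformedAlgebraicHull.lean`), the duplication chain (`SoloInformedDuplicationChain.lean`),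
the `√3`-chain (`SoloInformedIsogenyChain.lean`) and the transcendence inputs of Theorems IX, IX″
(Chudnovsky on `π, Γ(¼)` and `π, Γ(⅓)`, landed as the independence of `![B(a,½), π]` for
`a = ¼, ⅓, ⅙`) give, UNCONDITIONALLY:

* `KZP` holds for every pair of representations (any dimensions) with classes in the `K`-hull
  `K[⟦β(a,½)⟧, ⟦π⟧]`, `a ∈ {¼, ⅓, ⅙}` (`soloInformed_kzp_on_hull_beta{Quarter,Third,Sixth}Half_pi`)
  — `K` = ALL real algebraic numbers, so algebraic multipliers are free;
* these hulls contain, by chains DERIVED FROM THE MOVES: `⟦β(a,a)⟧` for the same `a`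
  (`soloInformed_betaSymm_mem_algHull`, duplication: `⟦β(a,a)⟧ = ⟦[pt, 2·4^{−a}]⟧⟦β(a,½)⟧`, and
  point classes of non-zero algebraic numbers are units of `P`, `soloInformed_pointRep_inv_mul`),
  and `K[⟦β(⅓,½)⟧,⟦π⟧] ∋ ⟦β(⅙,½)⟧` (`soloInformed_betaSixthHalf_mem_algHull`, isogeny), hence
  also `⟦β(⅙,⅙)⟧`;
* sample: a pinned `β(¼,¼)` is move-equivalent to ANY representation of the same value whose
  class lies in `K[⟦β(¼,½)⟧,⟦π⟧]` (`soloInformed_equivalent_betaQuarterQuarter`);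
* the lemniscatic duplication in closed form, by the moves:
  `⟦[pt,√2]⟧·⟦β(¼,¼)⟧ = 2⟦β(¼,½)⟧` (`soloInformed_lemniscatic_duplication`; `4^{¼} = √2`).

This is rung S2 of paper §6octies in final form: every sector question of this kind reduces to
ONE transcendence input for the generators (rung S1) plus chains; what remains open at rung S3
is a sector with THREE algebraically independent generators (e.g. `β(¼,½), β(⅓,½), π`), i.e.
the algebraic independence of `π, Γ(¼), Γ(⅓)` — an open problem (paper §8).
Residency `solo-KontsevichZagierPeriods-informed` (s22); paper §6octies.

References: M. Kontsevich, D. Zagier, *Periods* (2001), §1.2; G. V. Chudnovsky, *Contributions to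
the theory of transcendental numbers* (1984), Ch. 7; M. Waldschmidt, *Elliptic functions and
transcendence* (2008), Cor. 33.
-/

noncomputable section

open MeasureTheory Set Filter
namespace Summit.KontsevichZagierPeriods.KontsevichZagierPeriods.Theorems

open Literature.NumberTheory.Transcendental Literature.NumberTheory.Transcendental.KZ
open Literature.ModelTheory.ExponentialFields

/-! ### Point classes by value, inverses -/

/-- An algebraic real number lies in `K = integralClosure ℚ ℝ`. [folklore] -/
theorem soloInformed_mem_integralClosure_of_isAlgebraic {x : ℝ} (hx : IsAlgebraic ℚ x) :
    x ∈ integralClosure ℚ ℝ :=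
  (mem_integralClosure_iff ℚ ℝ).2 hx.isIntegral

/-- The point class `⟦[pt, x]⟧` of an algebraic `x` lies in every `K`-hull. [this work] -/
theorem soloInformed_pointRep_mem_algHull {k : ℕ} (c : Fin k → FormalPeriodRing) (x : ℝ)
    (hx : IsAlgebraic ℚ x) :
    toFormalPeriod (of (IntegralRep.unit.constMul x hx)) ∈ soloInformedAlgHull c := by
  rw [← soloInformed_pointHom_apply x (soloInformed_mem_integralClosure_of_isAlgebraic hx) hx]
  exact soloInformed_pointHom_mem_algHull c _

/-- **Point classes of non-zero algebraic numbers are units**: `⟦[pt, x⁻¹]⟧ · ⟦[pt, x]⟧ = 1`.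
[this work] -/
theorem soloInformed_pointRep_inv_mul (x : ℝ) (hx : IsAlgebraic ℚ x) (hx0 : x ≠ 0)
    (hxi : IsAlgebraic ℚ x⁻¹) :
    toFormalPeriod (of (IntegralRep.unit.constMul x⁻¹ hxi)) *
      toFormalPeriod (of (IntegralRep.unit.constMul x hx)) = 1 := by
  rw [← soloInformed_pointHom_apply x⁻¹ (soloInformed_mem_integralClosure_of_isAlgebraic hxi) hxi,
    ← soloInformed_pointHom_apply x (soloInformed_mem_integralClosure_of_isAlgebraic hx) hx,
    ← map_mul, ← map_one soloInformedPointHom]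
  congr 1
  exact Subtype.ext (inv_mul_cancel₀ hx0)

/-- Two point classes with the same value are equal (any proofs of algebraicity). [folklore] -/
theorem soloInformed_pointRep_congr {x y : ℝ} (hx : IsAlgebraic ℚ x) (hy : IsAlgebraic ℚ y)
    (h : x = y) :
    toFormalPeriod (of (IntegralRep.unit.constMul x hx)) =
      toFormalPeriod (of (IntegralRep.unit.constMul y hy)) := by
  subst h
  rfl

/-- Independence of a pair of values, in the form the hull theorems consume. [folklore] -/
theorem soloInformed_algebraicIndependent_evalP_pair {u v : FormalPeriodRing}
    (h : AlgebraicIndependent ℚ ![evalP u, evalP v]) :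
    AlgebraicIndependent ℚ fun i => evalP (![u, v] i) := by
  convert h using 1
  funext i
  fin_cases i <;> rfl

/-! ### The hulls fed by the chains: `⟦β(a,a)⟧`, `⟦β(⅙,½)⟧` -/

/-- **`⟦β(a,a)⟧` lies in the `K`-hull of any family whose hull contains `⟦β(a,½)⟧`**
(duplication chain, and `⟦[pt,4^a]⟧` is a unit of `K ⊂ P`): for every rational `a`. [this work] -/
theorem soloInformed_betaSymm_mem_algHull (a : ℚ) (A B : IntegralRep 1)
    (hAd : A.domain = {t | t 0 ∈ Ioo (0:ℝ) 1})
    (hAi : EqOn A.integrand (fun t => (t 0) ^ ((a : ℝ) - 1) * (1 - t 0) ^ ((a : ℝ) - 1)) A.domain)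
    (hBd : B.domain = {t | t 0 ∈ Ioo (0:ℝ) 1})
    (hBi : EqOn B.integrand
      (fun t => (t 0) ^ ((a : ℝ) - 1) * (1 - t 0) ^ (((1 / 2 : ℚ) : ℝ) - 1)) B.domain)
    {k : ℕ} (c : Fin k → FormalPeriodRing) (hB : toFormalPeriod (of B) ∈ soloInformedAlgHull c) :
    toFormalPeriod (of A) ∈ soloInformedAlgHull c := by
  have h4 : (4:ℝ) ^ (a : ℝ) ≠ 0 := (Real.rpow_pos_of_pos (by norm_num) _).ne'
  have h4a : IsAlgebraic ℚ ((4:ℝ) ^ (a : ℝ)) := by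
    simpa using soloInformed_isAlgebraic_natCast_rpow_ratCast 4 (by norm_num) a
  have hinv : IsAlgebraic ℚ ((4:ℝ) ^ (a : ℝ))⁻¹ := by
    have : IsAlgebraic ℚ ((4:ℝ) ^ ((-a : ℚ) : ℝ)) := by
      simpa using soloInformed_isAlgebraic_natCast_rpow_ratCast 4 (by norm_num) (-a)
    rwa [Rat.cast_neg, Real.rpow_neg (by norm_num)] at this
  have hchain := soloInformed_duplication_chain a h4a A B hAd hAi hBd hBi
  have hA : toFormalPeriod (of A) = toFormalPeriod (of (IntegralRep.unit.constMul
      ((4:ℝ) ^ (a : ℝ))⁻¹ hinv)) * (2 * toFormalPeriod (of B)) := by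
    rw [← hchain, ← mul_assoc, soloInformed_pointRep_inv_mul _ _ h4 hinv, one_mul]
  rw [hA]
  exact mul_mem (soloInformed_pointRep_mem_algHull c _ hinv) (mul_mem (ofNat_mem _ 2) hB)

/-- **`⟦β(⅙,½)⟧` lies in the `K`-hull of any family whose hull contains `⟦β(⅓,½)⟧`**
(the `√3`-chain of Theorem IX‴). [this work] -/
theorem soloInformed_betaSixthHalf_mem_algHull (B₃ B₆ : IntegralRep 1)
    (hB₃d : B₃.domain = {t | t 0 ∈ Ioo (0:ℝ) 1})
    (hB₃i : EqOn B₃.integrand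
      (fun t => (t 0) ^ (((1 / 3 : ℚ) : ℝ) - 1) * (1 - t 0) ^ (((1 / 2 : ℚ) : ℝ) - 1)) B₃.domain)
    (hB₆d : B₆.domain = {t | t 0 ∈ Ioo (0:ℝ) 1})
    (hB₆i : EqOn B₆.integrand
      (fun t => (t 0) ^ (((1 / 6 : ℚ) : ℝ) - 1) * (1 - t 0) ^ (((1 / 2 : ℚ) : ℝ) - 1)) B₆.domain)
    {k : ℕ} (c : Fin k → FormalPeriodRing) (hB₃ : toFormalPeriod (of B₃) ∈ soloInformedAlgHull c) :
    toFormalPeriod (of B₆) ∈ soloInformedAlgHull c := by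
  rw [soloInformed_isogeny_chain B₃ B₆ hB₃d hB₃i hB₆d hB₆i]
  exact mul_mem (soloInformed_pointRep_mem_algHull c _ _) hB₃

/-! ### THEOREM IX⁗ (III): three hulls decided unconditionally -/

/-- **The hull `K[⟦β(¼,½)⟧, ⟦π⟧]` is decided** (input: Chudnovsky on `π, Γ(¼)` via Theorem IX):
`KZP` holds for all pairs of representations with classes in it; it contains `⟦β(¼,¼)⟧`
(`soloInformed_betaSymm_mem_algHull`), `⟦β(¾,½)⟧`, `⟦β(¼,½)·√2⟧`, … [this work] -/
theorem soloInformed_kzp_on_hull_betaQuarterHalf_pi (B : IntegralRep 1)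
    (hBd : B.domain = {t | t 0 ∈ Ioo (0:ℝ) 1})
    (hBi : EqOn B.integrand
      (fun t => (t 0) ^ (((1 / 4 : ℚ) : ℝ) - 1) * (1 - t 0) ^ (((1 / 2 : ℚ) : ℝ) - 1)) B.domain)
    {n m : ℕ} (r : IntegralRep n) (r' : IntegralRep m)
    (hr : toFormalPeriod (of r) ∈
      soloInformedAlgHull ![toFormalPeriod (of B), toFormalPeriod (of KZ.piRep)])
    (hr' : toFormalPeriod (of r') ∈
      soloInformedAlgHull ![toFormalPeriod (of B), toFormalPeriod (of KZ.piRep)])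
    (hv : r.value = r'.value) : Equivalent r r' := by
  refine soloInformed_kzp_on_algHull _ (soloInformed_algebraicIndependent_evalP_pair ?_)
    r r' hr hr' hv
  rw [evalP_toFormalPeriod_of, evalP_toFormalPeriod_of, piRep_value]
  exact soloInformed_algebraicIndependent_betaQuarterHalf_pi B hBd hBi

/-- **The hull `K[⟦β(⅓,½)⟧, ⟦π⟧]` is decided** (input: Chudnovsky on `π, Γ(⅓)` via Theorem IX″):
it contains `⟦β(⅓,⅓)⟧` (duplication) and `⟦β(⅙,½)⟧` (isogeny), hence also `⟦β(⅙,⅙)⟧`.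
[this work] -/
theorem soloInformed_kzp_on_hull_betaThirdHalf_pi (B : IntegralRep 1)
    (hBd : B.domain = {t | t 0 ∈ Ioo (0:ℝ) 1})
    (hBi : EqOn B.integrand
      (fun t => (t 0) ^ (((1 / 3 : ℚ) : ℝ) - 1) * (1 - t 0) ^ (((1 / 2 : ℚ) : ℝ) - 1)) B.domain)
    {n m : ℕ} (r : IntegralRep n) (r' : IntegralRep m)
    (hr : toFormalPeriod (of r) ∈
      soloInformedAlgHull ![toFormalPeriod (of B), toFormalPeriod (of KZ.piRep)])
    (hr' : toFormalPeriod (of r') ∈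
      soloInformedAlgHull ![toFormalPeriod (of B), toFormalPeriod (of KZ.piRep)])
    (hv : r.value = r'.value) : Equivalent r r' := by
  refine soloInformed_kzp_on_algHull _ (soloInformed_algebraicIndependent_evalP_pair ?_)
    r r' hr hr' hv
  rw [evalP_toFormalPeriod_of, evalP_toFormalPeriod_of, piRep_value]
  exact soloInformed_algebraicIndependent_betaThirdHalf_pi B hBd hBi

/-- **The hull `K[⟦β(⅙,½)⟧, ⟦π⟧]` is decided** (same input); it contains `⟦β(⅙,⅙)⟧`.
[this work] -/
theorem soloInformed_kzp_on_hull_betaSixthHalf_pi (B : IntegralRep 1)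
    (hBd : B.domain = {t | t 0 ∈ Ioo (0:ℝ) 1})
    (hBi : EqOn B.integrand
      (fun t => (t 0) ^ (((1 / 6 : ℚ) : ℝ) - 1) * (1 - t 0) ^ (((1 / 2 : ℚ) : ℝ) - 1)) B.domain)
    {n m : ℕ} (r : IntegralRep n) (r' : IntegralRep m)
    (hr : toFormalPeriod (of r) ∈
      soloInformedAlgHull ![toFormalPeriod (of B), toFormalPeriod (of KZ.piRep)])
    (hr' : toFormalPeriod (of r') ∈
      soloInformedAlgHull ![toFormalPeriod (of B), toFormalPeriod (of KZ.piRep)])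
    (hv : r.value = r'.value) : Equivalent r r' := by
  refine soloInformed_kzp_on_algHull _ (soloInformed_algebraicIndependent_evalP_pair ?_)
    r r' hr hr' hv
  rw [evalP_toFormalPeriod_of, evalP_toFormalPeriod_of, piRep_value]
  exact soloInformed_algebraicIndependent_betaSixthHalf_pi B hBd hBi

/-- **Sample consequence (pinned `β(¼,¼)` vs anything in the lemniscatic hull).** If `A = β(¼,¼)`
(pinned) has the same value as a representation `r'` whose class lies in `K[⟦β(¼,½)⟧, ⟦π⟧]`,
then `A ∼ r'` by the moves — unconditionally. [this work] -/
theorem soloInformed_equivalent_betaQuarterQuarter (A B : IntegralRep 1)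
    (hAd : A.domain = {t | t 0 ∈ Ioo (0:ℝ) 1})
    (hAi : EqOn A.integrand
      (fun t => (t 0) ^ (((1 / 4 : ℚ) : ℝ) - 1) * (1 - t 0) ^ (((1 / 4 : ℚ) : ℝ) - 1)) A.domain)
    (hBd : B.domain = {t | t 0 ∈ Ioo (0:ℝ) 1})
    (hBi : EqOn B.integrand
      (fun t => (t 0) ^ (((1 / 4 : ℚ) : ℝ) - 1) * (1 - t 0) ^ (((1 / 2 : ℚ) : ℝ) - 1)) B.domain)
    {m : ℕ} (r' : IntegralRep m)
    (hr' : toFormalPeriod (of r') ∈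
      soloInformedAlgHull ![toFormalPeriod (of B), toFormalPeriod (of KZ.piRep)])
    (hv : A.value = r'.value) : Equivalent A r' :=
  soloInformed_kzp_on_hull_betaQuarterHalf_pi B hBd hBi A r'
    (soloInformed_betaSymm_mem_algHull (1 / 4) A B hAd hAi hBd hBi _
      (soloInformed_mem_algHull_self _ 0)) hr' hv

/-! ### The lemniscatic duplication in closed form: `⟦[pt,√2]⟧·⟦β(¼,¼)⟧ = 2⟦β(¼,½)⟧` -/

/-- **Lemniscatic duplication by the moves**: `⟦[pt, √2]⟧ · ⟦β(¼,¼)⟧ = 2 · ⟦β(¼,½)⟧`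
(classically `√2 · Γ(¼)²/√π = 2 · Γ(¼)Γ(½)/Γ(¾)`, i.e. `Γ(¼)Γ(¾) = π√2`). [this work] -/
theorem soloInformed_lemniscatic_duplication (A B : IntegralRep 1)
    (hAd : A.domain = {t | t 0 ∈ Ioo (0:ℝ) 1})
    (hAi : EqOn A.integrand
      (fun t => (t 0) ^ (((1 / 4 : ℚ) : ℝ) - 1) * (1 - t 0) ^ (((1 / 4 : ℚ) : ℝ) - 1)) A.domain)
    (hBd : B.domain = {t | t 0 ∈ Ioo (0:ℝ) 1})
    (hBi : EqOn B.integrand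
      (fun t => (t 0) ^ (((1 / 4 : ℚ) : ℝ) - 1) * (1 - t 0) ^ (((1 / 2 : ℚ) : ℝ) - 1)) B.domain) :
    toFormalPeriod (of (IntegralRep.unit.constMul (Real.sqrt 2)
        (soloInformed_isAlgebraic_sqrt_natCast 2))) * toFormalPeriod (of A) =
      2 * toFormalPeriod (of B) := by
  have h4 : IsAlgebraic ℚ ((4:ℝ) ^ (((1 / 4 : ℚ)) : ℝ)) := by
    simpa using soloInformed_isAlgebraic_natCast_rpow_ratCast 4 (by norm_num) (1 / 4)
  have hq : (4:ℝ) ^ (((1 / 4 : ℚ) : ℝ)) = Real.sqrt 2 := by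
    have h1 : (0:ℝ) ≤ (4:ℝ) ^ (((1 / 4 : ℚ) : ℝ)) := Real.rpow_nonneg (by norm_num) _
    have h2 : (0:ℝ) ≤ Real.sqrt 2 := Real.sqrt_nonneg 2
    rw [← pow_left_inj₀ h1 h2 (by norm_num : (4:ℕ) ≠ 0), ← Real.rpow_natCast, ← Real.rpow_mul
      (by norm_num), show (4:ℕ) = 2 * 2 from rfl, pow_mul, Real.sq_sqrt (by norm_num)]
    push_cast
    norm_num
  rw [← soloInformed_duplication_chain (1 / 4) h4 A B hAd hAi hBd hBi,
    soloInformed_pointRep_congr (y := Real.sqrt 2) h4 (soloInformed_isAlgebraic_sqrt_natCast 2) hq]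

end Summit.KontsevichZagierPeriods.KontsevichZagierPeriods.Theorems

end
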